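import Summits.QuantumAdvantage.QuantumAdvantage.Theorems.CubicStability.Negative.P4Witness
import Summits.QuantumAdvantage.QuantumAdvantage.Theorems.CubicForrelationInPrBPP.Negative.SignedSlice

/-!
# `CubicStability` (stmt-QuantumAdvantage-2202), negative side — Walsh lemmas and the finite facts of `P₄`

Support file 2/2 for the refutation of
`Summit.QuantumAdvantage.QuantumAdvantage.Theses.CubicForrelation.CubicStability`: generic Walsh
analysis on `𝔽₂ⁿ` for real `±1`-valued functions (Fourier inversion, Plancherel, the Cauchy–Schwarz
equality case `∑ f W_g = c 2ⁿ, c² = 2ⁿ ⇒ W_g = c f` and bentness of the dual, correlation versus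
Hamming distance; Parseval is `sum_W_sq_of_sq` of `SignedSlice.lean`), and the finite facts about the
witness of `P4Witness.lean`: `∑_u P = 1296`, `∑_u P(u)(-1)^{u^k·w} = -432` (`w ≠ 0`),
`w(u) = (-1)^{a(u)} W_b(u) = ∏_k m(u^k)`, `∑_u w = 160000` — hence
`Φ(a,b) = 160000/2^18 = 625/1024 ≥ 3/5` — and the pointwise pattern inequalities `48 t ≤ w`,
`-P z ≤ t`. Everything is a theorem. (refuter-cruxtri-stmt-QuantumAdvantage-2202-r1-3-0, 2026-08-16.)
-/

noncomputable section

open Finset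
open Literature.Computability.QuantumComplexity
open Literature.Computability.QuantumComplexity.DerivativeWalsh (W fsum fsum_eq_sum_mul_W)
open Literature.Computability.QuantumComplexity.BuzetChailloux (phi phi_signOf)
open Literature.Computability.QuantumComplexity.Simon (twist_xor_left sum_twist)
open Summit.QuantumAdvantage.QuantumAdvantage.Theorems.CubicForrelationInPrBPP.Negative (sum_W_sq_of_sq)

namespace Summit.QuantumAdvantage.QuantumAdvantage.Theorems.CubicStability.Negative.P4

/-! ### Generic Walsh analysis on `𝔽₂ⁿ` (real `±1`-valued functions) -/

section Walsh

variable {n : ℕ}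

/-- Fourier inversion: `∑_x (-1)^{u·x} W_h(x) = 2ⁿ h(u)`. [folklore] -/
theorem sum_twist_mul_W (h : (Fin n → Bool) → ℝ) (u : Fin n → Bool) :
    ∑ x, twist u x * W h x = (2 : ℝ) ^ n * h u := by
  have step : ∀ x : Fin n → Bool, twist u x * W h x = ∑ y, h y * twist (fun i => u i ^^ y i) x := by
    intro x
    rw [W, mul_sum]
    refine sum_congr rfl fun y _ => ?_
    rw [twist_xor_left]
    ring
  rw [sum_congr rfl fun x _ => step x, sum_comm]
  have key : ∀ y : Fin n → Bool, ((fun i => u i ^^ y i) = fun _ => false) ↔ y = u := by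
    intro y
    constructor
    · intro hxy
      funext i
      have hi : (u i ^^ y i) = false := congrFun hxy i
      revert hi
      cases u i <;> cases y i <;> simp
    · rintro rfl
      funext i
      exact Bool.xor_self _
  have inner : ∀ y : Fin n → Bool,
      ∑ x, h y * twist (fun i => u i ^^ y i) x = h y * (if y = u then (2 : ℝ) ^ n else 0) := by
    intro y
    rw [← mul_sum, sum_twist]
    congr 1
    exact if_congr (key y) rfl rfl
  rw [sum_congr rfl fun y _ => inner y]
  simp_rw [mul_ite, mul_zero, Finset.sum_ite_eq' univ, if_pos (mem_univ _)]
  ring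

/-- Plancherel: `∑_x W_g(x) W_{g'}(x) = 2ⁿ ∑_y g(y) g'(y)`. [folklore] -/
theorem sum_W_mul_W (g g' : (Fin n → Bool) → ℝ) :
    ∑ x, W g x * W g' x = (2 : ℝ) ^ n * ∑ y, g y * g' y := by
  have step : ∀ x : Fin n → Bool, W g x * W g' x = ∑ y, g' y * (twist y x * W g x) := by
    intro x
    rw [show W g' x = ∑ y, g' y * twist y x from rfl, mul_sum]
    exact sum_congr rfl fun y _ => by ring
  rw [sum_congr rfl fun x _ => step x, sum_comm, mul_sum]
  refine sum_congr rfl fun y _ => ?_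
  rw [← mul_sum, sum_twist_mul_W]
  ring

/-- `∑_x f(x)² = 2ⁿ` for a `±1`-valued `f`. [folklore] -/
theorem sum_sq_eq (f : (Fin n → Bool) → ℝ) (hf : ∀ x, f x ^ 2 = 1) : ∑ x, f x ^ 2 = (2 : ℝ) ^ n := by
  simp_rw [hf]
  simp only [sum_const, card_univ, Fintype.card_fun, Fintype.card_bool, Fintype.card_fin,
    nsmul_eq_mul, mul_one]
  push_cast
  ring

/-- Cauchy–Schwarz equality: if `∑_x f(x) W_g(x) = c · 2ⁿ` with `c² = 2ⁿ` for `±1`-valued `f, g`,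
then `W_g = c · f` pointwise (`g` is bent with dual `f`). [folklore] -/
theorem W_eq_of_fsum_eq (f g : (Fin n → Bool) → ℝ) (hf : ∀ x, f x ^ 2 = 1) (hg : ∀ y, g y ^ 2 = 1)
    (c : ℝ) (hc : c ^ 2 = (2 : ℝ) ^ n) (hS : ∑ x, f x * W g x = c * 2 ^ n) :
    ∀ x, W g x = c * f x := by
  have e : ∀ x, (W g x - c * f x) ^ 2 = W g x ^ 2 - 2 * c * (f x * W g x) + c ^ 2 * f x ^ 2 := by
    intro x; ring
  have h1 : ∑ x, (W g x - c * f x) ^ 2 =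
      ∑ x, W g x ^ 2 - 2 * c * ∑ x, f x * W g x + c ^ 2 * ∑ x, f x ^ 2 := by
    simp_rw [e]
    rw [sum_add_distrib, sum_sub_distrib, ← mul_sum, ← mul_sum]
  have hsum : ∑ x, (W g x - c * f x) ^ 2 = 0 := by
    rw [h1, sum_W_sq_of_sq g hg, hS, sum_sq_eq f hf]
    linear_combination (-(2 : ℝ) ^ n) * hc
  intro x
  have hx := (sum_eq_zero_iff_of_nonneg (fun y _ => sq_nonneg (W g y - c * f y))).1 hsum x (mem_univ x)
  have : W g x - c * f x = 0 := pow_eq_zero_iff (n := 2) (by norm_num) |>.1 hx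
  linarith

/-- The dual of a bent function is bent: if `W_g = c · f` with `c² = 2ⁿ`, `c ≠ 0`, then
`W_f = c · g`. [folklore] -/
theorem W_dual (f g : (Fin n → Bool) → ℝ) (c : ℝ) (hc : c ^ 2 = (2 : ℝ) ^ n) (hc0 : c ≠ 0)
    (hW : ∀ x, W g x = c * f x) : ∀ u, W f u = c * g u := by
  intro u
  have h1 : c * W f u = ∑ x, twist u x * W g x := by
    rw [show W f u = ∑ x, f x * twist x u from rfl, mul_sum]
    refine sum_congr rfl fun x _ => ?_
    rw [hW x, twist_comm]
    ring
  rw [sum_twist_mul_W, ← hc] at h1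
  have : c * (W f u - c * g u) = 0 := by rw [mul_sub, h1]; ring
  rcases mul_eq_zero.1 this with h | h
  · exact absurd h hc0
  · linarith

/-- Correlation versus Hamming distance for Boolean functions:
`2ⁿ = ∑_y (-1)^{g(y)} (-1)^{g₀(y)} + 2 · #{g ≠ g₀}`. [folklore] -/
theorem two_pow_eq_corr_add (g g₀ : (Fin n → Bool) → Bool) :
    (2 : ℝ) ^ n = ∑ y, signOf (g y) * signOf (g₀ y) + 2 * (CubicStability.Negative.hdist g g₀ : ℝ) := by
  unfold CubicStability.Negative.hdist
  have e : ∀ y : Fin n → Bool,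
      signOf (g y) * signOf (g₀ y) = 1 - 2 * (if g y ≠ g₀ y then 1 else 0) := by
    intro y
    cases g y <;> cases g₀ y <;> norm_num [signOf]
  simp_rw [e, sum_sub_distrib, ← mul_sum]
  rw [sum_boole]
  simp only [sum_const, card_univ, Fintype.card_fun, Fintype.card_bool, Fintype.card_fin,
    nsmul_eq_mul, mul_one]
  push_cast
  ring

/-- `|signOf b| ≤ 1` in the two directions we use. [folklore] -/
theorem signOf_le_one (b : Bool) : signOf b ≤ 1 := by cases b <;> norm_num [signOf]

/-- `-1 ≤ signOf b`. [folklore] -/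
theorem neg_one_le_signOf (b : Bool) : -1 ≤ signOf b := by cases b <;> norm_num [signOf]

end Walsh

/-! ### The finite facts about the witness -/

/-- `(-1)^{a(u)} (-1)^{u·1¹²} = P(u)`. [folklore] -/
theorem sf_twist_xstar (u : Fin (4 * 3) → Bool) : signOf (fA u) * twist u xstar = P u := by
  rw [sf_eq, twist_blocks, ← prod_mul_distrib]
  unfold P
  refine prod_congr rfl fun k _ => ?_
  exact eps_eq (blk u k)

/-- `∑_u P(u) = (-6)⁴ = 1296 = W_a(1¹²)`. [folklore] -/
theorem sum_P : ∑ u, P u = 1296 := by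
  unfold P
  have key := sum_prod_blocks (fun _ v => eps v)
  rw [key]
  simp_rw [sum_eps]
  norm_num [prod_const]

/-- `∑_u P(u) (-1)^{u^k·w} = (-6)³ · 2 = -432 = W_a(1¹² ⊕ e(k,w))` for `w ≠ 0`. [folklore] -/
theorem sum_P_twist (k : Fin 4) (w : V) (hw : w ≠ zero3) : ∑ u, P u * twist (blk u k) w = -432 := by
  have e : ∀ u : Fin (4 * 3) → Bool, P u * twist (blk u k) w =
      ∏ j, (eps (blk u j) * if j = k then twist (blk u j) w else 1) := by
    intro u
    unfold P
    rw [prod_mul_distrib, prod_ite_eq' univ, if_pos (mem_univ _)]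
  simp_rw [e]
  have key := sum_prod_blocks (fun j v => eps v * if j = k then twist v w else 1)
  rw [key]
  have inner : ∀ j : Fin 4, ∑ v : V, (eps v * if j = k then twist v w else 1) = if j = k then 2 else -6 := by
    intro j
    split_ifs
    · exact sum_eps_twist w hw
    · simp_rw [mul_one]; exact sum_eps
  simp_rw [inner]
  fin_cases k <;> simp [Fin.prod_univ_four] <;> norm_num


/-- The Walsh transform of `(-1)^b` factorises over the blocks. [folklore] -/
theorem W_sg (x : Fin (4 * 3) → Bool) :
    W (fun y => signOf (gB y)) x = ∏ k, W (fun v => signOf (c3 v)) (blk x k) := by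
  have key := W_blocks (fun _ v => signOf (c3 v)) x
  rw [← key]
  congr 1
  funext y
  exact sg_eq y

/-- The weight `w(u) = (-1)^{a(u)} W_b(u) = ∏_k m(u^k) = 6^{z(u)} 2^{4 - z(u)}`. [folklore] -/
theorem w_eq (u : Fin (4 * 3) → Bool) :
    signOf (fA u) * W (fun y => signOf (gB y)) u = ∏ k, mV (blk u k) := by
  rw [sf_eq, W_sg, ← prod_mul_distrib]
  exact prod_congr rfl fun k _ => mV_eq (blk u k)

/-- `∑_u (-1)^{a(u)} W_b(u) = 20⁴ = 160000` (the forrelation sum of the witness). [folklore] -/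
theorem sum_w : ∑ u, signOf (fA u) * W (fun y => signOf (gB y)) u = 160000 := by
  simp_rw [w_eq]
  have key := sum_prod_blocks (fun _ v => mV v)
  rw [key]
  simp_rw [sum_mV]
  norm_num [prod_const]


/-- The two pattern inequalities, over the 16 zero-patterns of the blocks. [folklore] -/
theorem pattern_ineq (p : Fin 4 → Prop) [DecidablePred p] :
    48 * (if Odd (univ.filter p).card then ((univ.filter p).card : ℝ) else 0) ≤
        ∏ k, (if p k then (6 : ℝ) else 2) ∧
      -((∏ k, (if p k then (1 : ℝ) else -1)) * (univ.filter p).card) ≤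
        (if Odd (univ.filter p).card then ((univ.filter p).card : ℝ) else 0) := by
  rw [card_filter, Fin.sum_univ_four, Fin.prod_univ_four, Fin.prod_univ_four]
  by_cases h0 : p 0 <;> by_cases h1 : p 1 <;> by_cases h2 : p 2 <;> by_cases h3 : p 3 <;>
    simp [h0, h1, h2, h3] <;> norm_num [Nat.odd_iff]

/-- `48 · t(u) ≤ w(u)` pointwise. [folklore] -/
theorem w_ge (u : Fin (4 * 3) → Bool) : 48 * t u ≤ ∏ k, mV (blk u k) := by
  have := (pattern_ineq (fun k => blk u k = zero3)).1
  unfold t z mV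
  exact this

/-- `-P(u) z(u) ≤ t(u)` pointwise. [folklore] -/
theorem negPz_le (u : Fin (4 * 3) → Bool) : -(P u * z u) ≤ t u := by
  have := (pattern_ineq (fun k => blk u k = zero3)).2
  unfold t z P eps
  exact this

/-! #### The YES bound -/

/-- `√(2³⁶) = 2¹⁸`. [folklore] -/
theorem sqrt_two_pow_36 : Real.sqrt ((2 : ℝ) ^ (3 * (4 * 3))) = 2 ^ 18 := by
  rw [show (2 : ℝ) ^ (3 * (4 * 3)) = (2 ^ 18) ^ 2 by norm_num, Real.sqrt_sq (by positivity)]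

/-- `Φ(f,g) = 2^{-18} ∑_x (-1)^{f(x)} W_g(x)` on 12 bits. [folklore] -/
theorem forrelation_eq (f g : (Fin (4 * 3) → Bool) → Bool) :
    forrelation f g = (2 ^ 18 : ℝ)⁻¹ * ∑ x, signOf (f x) * W (fun y => signOf (g y)) x := by
  rw [← phi_signOf, DerivativeWalsh.phi_eq_fsum, fsum_eq_sum_mul_W, sqrt_two_pow_36]

/-- **The witness is a YES instance**: `Φ(a,b) = 160000/2^18 = 625/1024 ≥ 3/5`. [folklore] -/
theorem yes_fA_gB : (3 : ℝ) / 5 ≤ forrelation fA gB := by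
  rw [forrelation_eq, sum_w]; norm_num

end Summit.QuantumAdvantage.QuantumAdvantage.Theorems.CubicStability.Negative.P4
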